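import Mathlib
import Literature.NumberTheory.LFunctions.Zhang2022.Section11AFELineIntegrability
import HarnessLib

/-!
# Zhang (2022) §11, proof of Lemma 11.2 for `χψ` — sub-step (c) of `Z22:§11.u024` PROVED:
# the functional-equation split on `u = −1` (`Z22:§6.u009` for `χψ`) and the node `LineSplit11`

Topic `Literature/NumberTheory/LFunctions/Zhang2022` (Landau–Siegel audit tree; verdict-neutral).
Y. Zhang, *Discrete mean estimates and the Landau–Siegel zero*, arXiv:2211.02515v1 (2022)
[Zhang2022LandauSiegel] — **an unrefereed manuscript under adjudication** (campaign D-0069; nothing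
here bears on Theorems 1–2 or on Landau–Siegel zeros). Companion of `Section11AFEObjects`,
`Section11AFELineIntegrability`. PROVED: `feSplit_neg_one` — on the WHOLE line `u = −1`,
`L(s+w,χψ) = Z(s+w,χψ)(Σ_{n<N} + Σ_{n≥N})χψ̄(n)n^{−(1−s−w)}` (the functional equation (2.2), the
tree's `GammaFactor.LFunction_eq_Zfac_mul`, off the one point where `s + w` is real, and continuity
there; `χψ̄ = (χψ)⁻¹`); `lineSplit11_holds : LineSplit11` — the line integral `∫_{(−1)}` splits into
the (6.3)-, (6.2)-, (6.4)-, (6.5)-type pieces (integrability from `Section11AFELineIntegrability`).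

## References

* Y. Zhang, arXiv:2211.02515v1 (2022), §6 proof of Lemma 6.1, pp. 31–32, tex L1724, L1754;
  §11 p. 65. [cite: Zhang2022LandauSiegel, §6 Lemma 6.1 (proof); §11 Lemma 11.2]
-/

noncomputable section

open Complex Real ComplexConjugate MeasureTheory Set Filter Topology

namespace Literature.NumberTheory.LFunctions.Zhang2022.Section11AFE

open Skeleton GaussWeight Section6Statements

/-! ## §1. The functional-equation split on `u = −1` and the node `LineSplit11` -/

section BlockC

variable {D : ℕ} [NeZero D] (χ : DirichletCharacter ℂ D) (x : Chr D)

/-- **`Z22:§6.u009` for `χψ`, on the whole line `u = −1`** (also at the one point where `s + w`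
is real, by continuity): "by the functional equation (2.2) with `θ = χψ`,
`L(s+w,χψ) = Z(s+w,χψ)(Σ_{n<N} + Σ_{n≥N})χψ̄(n)n^{−(1−s−w)}`" (the tree's
`GammaFactor.LFunction_eq_Zfac_mul`, Mathlib's `LFunction_eq_LSeries` at `Re = 3/2`, and
`χψ̄ = (χψ)⁻¹`). [cite: Zhang2022LandauSiegel, §6 p. 31, tex L1724; §11 p. 65] -/
theorem feSplit_neg_one (hD : 3 ≤ D) (hp : χ.IsPrimitive) {s : ℂ} (hs : s.re = 1 / 2) (N : ℝ)
    (v : ℝ) :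
    (psiChi χ x).LFunction (s + (((-1 : ℝ) : ℂ) + (v : ℂ) * I)) =
      Zpc χ x (s + (((-1 : ℝ) : ℂ) + (v : ℂ) * I)) *
        (headPc χ x N s (((-1 : ℝ) : ℂ) + (v : ℂ) * I) + tailPc χ x N s (((-1 : ℝ) : ℂ) + (v : ℂ) * I)) := by
  set θ := psiChi χ x with hθ
  have hprim : θ.IsPrimitive := psiChiPrimitive_holds D χ x hD hp
  have hk1 : D * x.p ≠ 1 := by
    intro h; have := Nat.eq_one_of_mul_eq_one_right h; omega
  have hθ1 : θ ≠ 1 := GammaFactor.ne_one_of_isPrimitive hprim hk1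
  -- both sides are continuous in `v`
  set L : ℝ → ℂ := fun v => θ.LFunction (s + (((-1 : ℝ) : ℂ) + (v : ℂ) * I)) with hL
  set R : ℝ → ℂ := fun v => Zpc χ x (s + (((-1 : ℝ) : ℂ) + (v : ℂ) * I)) *
    (headPc χ x N s (((-1 : ℝ) : ℂ) + (v : ℂ) * I) + tailPc χ x N s (((-1 : ℝ) : ℂ) + (v : ℂ) * I))
    with hR
  have hLc : Continuous L :=
    (DirichletCharacter.differentiable_LFunction hθ1).continuous.comp (by fun_prop)
  have hRc : Continuous R := by
    have hZ := continuous_Zpc_line χ x (s := s) (c := -1) (by rw [hs]; norm_num)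
    exact hZ.mul ((continuous_headPc_line χ x N s (-1)).add (continuous_tailPc_neg_one χ x hs N).1)
  -- and agree off the single point `v = −Im s`
  have heq : Set.EqOn L R ({-s.im}ᶜ : Set ℝ) := by
    intro v hv
    have hv' : v ≠ -s.im := hv
    set w : ℂ := s + (((-1 : ℝ) : ℂ) + (v : ℂ) * I) with hw
    have him : w.im ≠ 0 := by
      rw [hw]; simp; intro h; exact hv' (by linarith)
    have hre3 : 1 < (1 - w).re := by rw [hw]; simp [hs]; norm_num
    have hFE := GammaFactor.LFunction_eq_Zfac_mul hprim hk1 him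
    -- the reflected series
    set f : ℕ → ℂ := fun n => conj (pc χ x n) * (n : ℂ) ^ (-(1 - s - (((-1 : ℝ) : ℂ) + (v : ℂ) * I)))
      with hf
    have hfterm : ∀ n, LSeries.term (fun n => θ⁻¹ (n : ZMod (D * x.p))) (1 - w) n = f n := by
      intro n
      rcases Nat.eq_zero_or_pos n with rfl | hn
      · have hne : (-(1 - s - (((-1 : ℝ) : ℂ) + (v : ℂ) * I))) ≠ 0 := by
          intro h0; have := congrArg Complex.re h0; simp [hs] at this; norm_num at this
        simp only [LSeries.term_zero, hf, Nat.cast_zero, Complex.zero_cpow hne, mul_zero]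
      · rw [LSeries.term_of_ne_zero hn.ne', hf, ← MulChar.star_apply', Complex.star_def,
          psiChi_natCast, div_eq_mul_inv, ← Complex.cpow_neg]
        congr 2
        rw [hw]; ring
    have hser : θ⁻¹.LFunction (1 - w) = ∑' n, f n := by
      rw [DirichletCharacter.LFunction_eq_LSeries _ hre3, LSeries]
      exact tsum_congr hfterm
    -- summability and the split at `⌈N⌉`
    have hsum : Summable fun n : ℕ => (n : ℝ) ^ (-(3 / 2 : ℝ)) :=
      Real.summable_nat_rpow.mpr (by norm_num)
    have hsf : Summable f := Summable.of_norm (Summable.of_nonneg_of_le (fun n => norm_nonneg _)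
      (fun n => norm_refl_term_le χ x hs n v) hsum)
    set g : ℕ → ℂ := fun n => if ⌈N⌉₊ ≤ n then f n else 0 with hg
    set h : ℕ → ℂ := fun n => if n < ⌈N⌉₊ then f n else 0 with hh
    have hfg : f = fun n => h n + g n := by
      funext n
      by_cases hn : ⌈N⌉₊ ≤ n
      · simp only [hg, hh, if_pos hn, if_neg (not_lt.mpr hn), zero_add]
      · simp only [hg, hh, if_neg hn, if_pos (not_le.mp hn), add_zero]
    have hhs : Summable h := summable_of_ne_finset_zero (s := Finset.range ⌈N⌉₊) (fun n hn => by
      simp only [Finset.mem_range, not_lt] at hn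
      simp only [hh, if_neg (not_lt.mpr hn)])
    have hgs : Summable g := by
      have : g = fun n => f n - h n := by funext n; rw [hfg]; ring
      rw [this]; exact hsf.sub hhs
    have hf0 : f 0 = 0 := by
      have hne : (-(1 - s - (((-1 : ℝ) : ℂ) + (v : ℂ) * I))) ≠ 0 := by
        intro h0; have := congrArg Complex.re h0; simp [hs] at this; norm_num at this
      simp only [hf, Nat.cast_zero, Complex.zero_cpow hne, mul_zero]
    have hhead : ∑' n, h n = headPc χ x N s (((-1 : ℝ) : ℂ) + (v : ℂ) * I) := by
      rw [tsum_eq_sum (s := Finset.range ⌈N⌉₊) (fun n hn => by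
        simp only [Finset.mem_range, not_lt] at hn; simp only [hh, if_neg (not_lt.mpr hn)])]
      have h1 : ∑ n ∈ Finset.range ⌈N⌉₊, h n = ∑ n ∈ Finset.range ⌈N⌉₊, f n :=
        Finset.sum_congr rfl fun n hn => by simp only [hh, if_pos (Finset.mem_range.mp hn)]
      rw [h1, headPc, Finset.range_eq_Ico]
      rcases Nat.eq_zero_or_pos ⌈N⌉₊ with h0 | hpos
      · rw [h0]; simp
      · rw [← Finset.sum_Ico_consecutive f (Nat.zero_le 1) hpos]
        have h01 : ∑ i ∈ Finset.Ico 0 1, f i = 0 := by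
          rw [Finset.sum_Ico_eq_sum_range]; simp [hf0]
        rw [h01, zero_add]
    have htail : ∑' n, g n = tailPc χ x N s (((-1 : ℝ) : ℂ) + (v : ℂ) * I) := rfl
    show L v = R v
    simp only [hL, hR]
    rw [← hw, hFE, hser, hfg, hhs.tsum_add hgs, hhead, htail, Zpc, hθ]
  have := Continuous.ext_on (dense_compl_singleton _) hLc hRc heq
  exact congrFun this v

/-- **(c) PROVED**: the node `LineSplit11` holds (for `D ≥ 3`): the functional-equation split on
`u = −1` and the linearity of the absolutely convergent line integrals.
[cite: Zhang2022LandauSiegel, §6 p. 31, tex L1724, L1754; §11 p. 65] -/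
theorem lineSplit11_holds : LineSplit11 := by
  refine ⟨3, fun D _ χ hD _hq hp x s hs z _hz1 _hz2 => ?_⟩
  obtain ⟨hre, _him⟩ := hs
  have hD2 : 2 ≤ D := le_trans (by norm_num) hD
  have hP : 0 < bigP D := Real.exp_pos _
  have hX : 0 < bigP D ^ z := Real.rpow_pos_of_pos hP z
  have hℓ : 0 < ell D := by
    have : (1 : ℝ) < D := by exact_mod_cast lt_of_lt_of_le (by norm_num) hD2
    exact Real.log_pos this
  have hR : 0 < bigR D := by
    rw [bigR]
    have : (0 : ℝ) < D := by exact_mod_cast lt_of_lt_of_le (by norm_num) hD2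
    exact mul_pos (mul_pos this hP) (pow_pos hℓ _)
  set X := bigP D ^ z
  set N := Skeleton.P1 D
  have e1 : (fun v : ℝ => integrandL χ x X s (((-1 : ℝ) : ℂ) + (v : ℂ) * I)) = fun v : ℝ =>
      integrandHead χ x X N s (((-1 : ℝ) : ℂ) + (v : ℂ) * I) +
        integrandTail χ x X N s (((-1 : ℝ) : ℂ) + (v : ℂ) * I) := by
    funext v
    rw [integrandL, integrandHead, integrandTail, feSplit_neg_one χ x hD hp hre N v]
    ring
  have e2 : (fun v : ℝ => integrandHead χ x X N s (((-1 : ℝ) : ℂ) + (v : ℂ) * I)) = fun v : ℝ =>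
      integrandMain χ x X N s (((-1 : ℝ) : ℂ) + (v : ℂ) * I) +
        integrandDiff χ x X N s (((-1 : ℝ) : ℂ) + (v : ℂ) * I) := by
    funext v
    simp only [integrandHead, integrandMain, integrandDiff]
    ring
  have iH := integrable_integrandHead χ x hD2 hre hX N
  have iT := integrable_integrandTail χ x hD2 hre hX N
  have iM := integrable_integrandMain χ x hD2 hre hX hR N
  have iD : Integrable fun v : ℝ => integrandDiff χ x X N s (((-1 : ℝ) : ℂ) + (v : ℂ) * I) := by
    have : (fun v : ℝ => integrandDiff χ x X N s (((-1 : ℝ) : ℂ) + (v : ℂ) * I)) = fun v : ℝ =>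
        integrandHead χ x X N s (((-1 : ℝ) : ℂ) + (v : ℂ) * I) -
          integrandMain χ x X N s (((-1 : ℝ) : ℂ) + (v : ℂ) * I) := by
      funext v
      have h2 := congrFun e2 v
      rw [h2]; ring
    rw [this]; exact iH.sub iM
  constructor
  · rw [vline, vline, vline, e1, integral_add iH iT]; ring
  · rw [vline, vline, vline, e2, integral_add iM iD]; ring

/-- `LineSplit11` — `_holds` alias of `lineSplit11_holds` above under the fact's exact name (appended
2026-08-28, D-0026 bookkeeping: the proof term is the existing theorem of this file; no statement,
definition or attribute is edited; no new named fact; the ledger's debt table listed the fact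
unproved). [cite: Zhang2022LandauSiegel, §6 p. 31, tex L1724, L1754; §11 p. 65] -/
theorem _root_.Literature.NumberTheory.LFunctions.Zhang2022.Section11AFE.LineSplit11_holds :
    LineSplit11 :=
  _root_.Literature.NumberTheory.LFunctions.Zhang2022.Section11AFE.lineSplit11_holds

end BlockC

end Literature.NumberTheory.LFunctions.Zhang2022.Section11AFE
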